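import Summits.HubbardSuperconductivity.HubbardSuperconductivity.Theorems.KLProgrammeKLRegimeScaleZeroCovarianceFarSiteHighShell
import Summits.HubbardSuperconductivity.HubbardSuperconductivity.Theorems.KLProgrammeKLRegimeScaleZeroCovarianceFarSiteWindow

/-!
# Route `KLProgramme`, crux K3 — engine-flow child (stmt-HubbardSuperconductivity-20437), stub (C) at `n = 0`, located item #22a «(C)-SCALE0-PT2»,
# the FAR-SITE supplier, HIGH SHELL summed over the Matsubara window, uniformly in β

Seat hubbard-kl-k3c5-p1 (g14; owner of #22a).  `…FarSiteHighShell.l2Far_high_of_strip` bounds the weighted far ℓ² at ONE frequency `|ω| ≥ klE0` by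
`Φ_high(ω) = 2ᵏ(50/|ω|)²·P(κ)·e^{−κ(Rc+1)}·S(κ)`, `κ = arsinh(|ω|/4)`, `P(κ) = max(1,2k/κ)ᵏ`, `S(κ) = (1+2/(1−e^{−κ/4}))²`.  All three κ-factors DECREASE
in κ and κ increases with |ω|, so above a crossover `ω₁ ≥ klE0` every `Φ_high(ω_i)` is `≤ 2ᵏ·2500·C(ω₁)/ω_i²`, `C(ω₁) = P(κ₁)e^{−κ₁(Rc+1)}S(κ₁)`, and the window
sum is β-uniform by `…FarSiteWindow.sum_inv_max_sq_matsubaraIdx_le` (`Σ_i 1/max(|ω_i|,ω₁)² ≤ β/ω₁`):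
**`sum_l2Far_high_le`**: `Σ_i [ω₁ ≤ |ω_i|]·(far ℓ² at ω_i) ≤ β·(2ᵏ·2500·C(ω₁)/ω₁)`.  With the LOW shell's `Φ_low` (kit Plancherel-complement certificate,
`|ω_i| < ω₁`) this is the `(1/β)Σ_i Φ i` of `farRows_le_of_l2Far`.

No definitions; nothing here asserts (C), any stub of 20437, K3 or superconductivity.
References: BGM 2006 §2.2 footnote 1, §3 (3.2) [cite: BenfattoGiulianiMastropietro2006].
-/

noncomputable section

namespace Summit.HubbardSuperconductivity.HubbardSuperconductivity.Theorems.KLRegimeSplit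

set_option linter.dupNamespace false -- summit = problem name (single-conjunct summit), D-0017

open Literature.MathematicalPhysics.QuantumLattice Literature.Probability.LatticeModels Literature.Analysis.FunctionSpaces
open Summit.HubbardSuperconductivity.HubbardSuperconductivity.Theorems.DispersionFlow
open MeasureTheory Set Finset Complex Real
open scoped Nat

variable {L : ℕ} [NeZero L]

/-- The high-shell constant is monotone: for `klE0 ≤ ω₁ ≤ |ω|` (so `κ₁ ≤ κ`),
`(50/|ω|)²·P(κ)·e^{−κ(Rc+1)}·S(κ) ≤ (2500/ω²)·P(κ₁)·e^{−κ₁(Rc+1)}·S(κ₁)`. -/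
theorem highShell_const_le {ω₁ om : ℝ} (hω₁ : 0 < ω₁) (hom : ω₁ ≤ |om|) (k Rc : ℕ) :
    (25 * (2 / |om|)) ^ 2 *
        ((max 1 ((2 * k : ℝ) / Real.arsinh (|om| / 4))) ^ k * Real.exp (-(Real.arsinh (|om| / 4) * (Rc + 1))) *
          (1 + 2 * (1 - Real.exp (-(Real.arsinh (|om| / 4) / 4)))⁻¹) ^ 2) ≤
      (2500 / om ^ 2) *
        ((max 1 ((2 * k : ℝ) / Real.arsinh (ω₁ / 4))) ^ k * Real.exp (-(Real.arsinh (ω₁ / 4) * (Rc + 1))) *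
          (1 + 2 * (1 - Real.exp (-(Real.arsinh (ω₁ / 4) / 4)))⁻¹) ^ 2) := by
  have hom0 : 0 < |om| := lt_of_lt_of_le hω₁ hom
  set κ₁ : ℝ := Real.arsinh (ω₁ / 4) with hκ₁
  set κ : ℝ := Real.arsinh (|om| / 4) with hκ
  have hκ₁0 : 0 < κ₁ := Real.arsinh_pos_iff.2 (by positivity)
  have hκle : κ₁ ≤ κ := Real.arsinh_le_arsinh.2 (by linarith)
  have hκ0 : 0 < κ := lt_of_lt_of_le hκ₁0 hκle
  have h25 : (25 * (2 / |om|)) ^ 2 = 2500 / om ^ 2 := by rw [mul_pow, div_pow, sq_abs]; ring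
  rw [h25]
  refine mul_le_mul_of_nonneg_left ?_ (by positivity)
  -- the three decreasing factors
  have hP : (max 1 ((2 * k : ℝ) / κ)) ^ k ≤ (max 1 ((2 * k : ℝ) / κ₁)) ^ k := by
    refine pow_le_pow_left₀ (by positivity) (max_le_max le_rfl ?_) k
    exact div_le_div_of_nonneg_left (by positivity) hκ₁0 hκle
  have hE : Real.exp (-(κ * (Rc + 1))) ≤ Real.exp (-(κ₁ * (Rc + 1))) := by
    rw [Real.exp_le_exp]; nlinarith
  have hρ₁ : Real.exp (-(κ₁ / 4)) < 1 := Real.exp_lt_one_iff.2 (by linarith)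
  have hρ : Real.exp (-(κ / 4)) ≤ Real.exp (-(κ₁ / 4)) := by rw [Real.exp_le_exp]; linarith
  have hS : (1 + 2 * (1 - Real.exp (-(κ / 4)))⁻¹) ^ 2 ≤ (1 + 2 * (1 - Real.exp (-(κ₁ / 4)))⁻¹) ^ 2 := by
    have h1 : 0 < 1 - Real.exp (-(κ₁ / 4)) := by linarith
    have h2 : (1 - Real.exp (-(κ / 4)))⁻¹ ≤ (1 - Real.exp (-(κ₁ / 4)))⁻¹ := by
      apply inv_anti₀ h1; linarith
    have h3 : 0 ≤ (1 - Real.exp (-(κ / 4)))⁻¹ := inv_nonneg.2 (by linarith)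
    exact pow_le_pow_left₀ (by positivity) (by linarith) 2
  exact mul_le_mul (mul_le_mul hP hE (Real.exp_pos _).le (by positivity)) hS (by positivity) (by positivity)

/-- **HIGH SHELL SUMMED OVER THE WINDOW, β-UNIFORM** (bare frame; `0 < β`; crossover `klE0 ≤ ω₁`; `e^{−arsinh(ω₁/4)L/2} ≤ 1/2`; any record `c`; `k : Fin 3`):
`Σ_{i : |ω_i| ≥ ω₁} (weighted far ℓ² at ω_i) ≤ β·(2ᵏ·2500·P(κ₁)e^{−κ₁(Rc+1)}S(κ₁)/ω₁)`. -/
theorem sum_l2Far_high_le (c : SunsetCellRecordV2) (μ : ℝ) {β ω₁ : ℝ} (hβ : 0 < β) (hω₁ : klE0 ≤ ω₁)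
    (hρ : Real.exp (-(Real.arsinh (ω₁ / 4) * L / 2)) ≤ 1 / 2) (M : ℕ) (k : Fin 3) :
    ∑ i : MatsubaraIdx M, (if ω₁ ≤ |matsubaraFreq β M i| then
      ∑ u : TorusSite 2 L,
        (if u ≠ 0 ∧ (fun j => (u j).valMinAbs : Site 2) ∉ c.disk then
          Real.sqrt ((((u 0).valMinAbs.natAbs : ℝ)) ^ 2 + (((u 1).valMinAbs.natAbs : ℝ)) ^ 2) ^ (k : ℕ) *
            ‖torusFourierInv (fun kv : TorusSite 2 L =>
              (fun y : Momentum => uvSymbolFn 1 klE0 (frameLevel μ 0 ((2 * π) • y)) (matsubaraFreq β M i))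
                (WithLp.toLp 2 fun j => ((kv j).val : ℝ) / L)) u‖ ^ 2
          else 0) else 0) ≤
      β * (2 ^ (k : ℕ) * 2500 *
        ((max 1 ((2 * (k : ℕ) : ℝ) / Real.arsinh (ω₁ / 4))) ^ (k : ℕ) * Real.exp (-(Real.arsinh (ω₁ / 4) * (c.Rc + 1))) *
          (1 + 2 * (1 - Real.exp (-(Real.arsinh (ω₁ / 4) / 4)))⁻¹) ^ 2) / ω₁) := by
  classical
  have hE0 : (0 : ℝ) < klE0 := by norm_num [klE0]
  have hω₁0 : 0 < ω₁ := lt_of_lt_of_le hE0 hω₁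
  set C : ℝ := (max 1 ((2 * (k : ℕ) : ℝ) / Real.arsinh (ω₁ / 4))) ^ (k : ℕ) * Real.exp (-(Real.arsinh (ω₁ / 4) * (c.Rc + 1))) *
    (1 + 2 * (1 - Real.exp (-(Real.arsinh (ω₁ / 4) / 4)))⁻¹) ^ 2 with hC
  have hκ₁0 : 0 < Real.arsinh (ω₁ / 4) := Real.arsinh_pos_iff.2 (by positivity)
  have hC0 : 0 ≤ C := by
    have : 0 < 1 - Real.exp (-(Real.arsinh (ω₁ / 4) / 4)) := by
      have := Real.exp_lt_one_iff.2 (show -(Real.arsinh (ω₁ / 4) / 4) < 0 by linarith); linarith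
    positivity
  -- per frequency above the crossover: the strip bound with the monotone constant
  have hterm : ∀ i : MatsubaraIdx M, (if ω₁ ≤ |matsubaraFreq β M i| then
      ∑ u : TorusSite 2 L,
        (if u ≠ 0 ∧ (fun j => (u j).valMinAbs : Site 2) ∉ c.disk then
          Real.sqrt ((((u 0).valMinAbs.natAbs : ℝ)) ^ 2 + (((u 1).valMinAbs.natAbs : ℝ)) ^ 2) ^ (k : ℕ) *
            ‖torusFourierInv (fun kv : TorusSite 2 L =>
              (fun y : Momentum => uvSymbolFn 1 klE0 (frameLevel μ 0 ((2 * π) • y)) (matsubaraFreq β M i))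
                (WithLp.toLp 2 fun j => ((kv j).val : ℝ) / L)) u‖ ^ 2
          else 0) else 0) ≤ 2 ^ (k : ℕ) * 2500 * C * (1 / max |matsubaraFreq β M i| ω₁ ^ 2) := by
    intro i
    split_ifs with hi
    · have homE : klE0 ≤ |matsubaraFreq β M i| := hω₁.trans hi
      -- the `L`-condition at this frequency follows from the one at ω₁ (κ monotone)
      have hκle : Real.arsinh (ω₁ / 4) ≤ Real.arsinh (|matsubaraFreq β M i| / 4) := Real.arsinh_le_arsinh.2 (by linarith)
      have hρi : Real.exp (-(Real.arsinh (|matsubaraFreq β M i| / 4) * L / 2)) ≤ 1 / 2 := by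
        refine le_trans ?_ hρ
        rw [Real.exp_le_exp]
        have hL : (0 : ℝ) ≤ L := Nat.cast_nonneg L
        nlinarith
      have h := l2Far_high_of_strip (L := L) c μ homE hρi k
      refine h.trans ?_
      have hmono := highShell_const_le hω₁0 hi (k : ℕ) c.Rc
      have hmax : max |matsubaraFreq β M i| ω₁ = |matsubaraFreq β M i| := max_eq_left hi
      rw [hmax]
      calc 2 ^ (k : ℕ) * (25 * (2 / |matsubaraFreq β M i|)) ^ 2 *
            ((max 1 ((2 * (k : ℕ) : ℝ) / Real.arsinh (|matsubaraFreq β M i| / 4))) ^ (k : ℕ) *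
              Real.exp (-(Real.arsinh (|matsubaraFreq β M i| / 4) * (c.Rc + 1))) *
              (1 + 2 * (1 - Real.exp (-(Real.arsinh (|matsubaraFreq β M i| / 4) / 4)))⁻¹) ^ 2)
          = 2 ^ (k : ℕ) * ((25 * (2 / |matsubaraFreq β M i|)) ^ 2 *
            ((max 1 ((2 * (k : ℕ) : ℝ) / Real.arsinh (|matsubaraFreq β M i| / 4))) ^ (k : ℕ) *
              Real.exp (-(Real.arsinh (|matsubaraFreq β M i| / 4) * (c.Rc + 1))) *
              (1 + 2 * (1 - Real.exp (-(Real.arsinh (|matsubaraFreq β M i| / 4) / 4)))⁻¹) ^ 2)) := by ring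
        _ ≤ 2 ^ (k : ℕ) * ((2500 / matsubaraFreq β M i ^ 2) * C) := mul_le_mul_of_nonneg_left hmono (by positivity)
        _ = 2 ^ (k : ℕ) * 2500 * C * (1 / |matsubaraFreq β M i| ^ 2) := by rw [sq_abs]; ring
    · positivity
  refine (Finset.sum_le_sum fun i _ => hterm i).trans ?_
  rw [← Finset.mul_sum]
  have hws := sum_inv_max_sq_matsubaraIdx_le hβ hω₁0 M
  calc 2 ^ (k : ℕ) * 2500 * C * ∑ i : MatsubaraIdx M, 1 / max |matsubaraFreq β M i| ω₁ ^ 2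
      ≤ 2 ^ (k : ℕ) * 2500 * C * (β / ω₁) := mul_le_mul_of_nonneg_left hws (by positivity)
    _ = β * (2 ^ (k : ℕ) * 2500 * C / ω₁) := by ring

end Summit.HubbardSuperconductivity.HubbardSuperconductivity.Theorems.KLRegimeSplit

end
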